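import Summits.QuantumFields.BalabanUV.Beta.EriceFlowEnclosureB12AsPrintedHistoryContagionShiftFlowZeroTangent

/-!
# Beta / EriceFlowEnclosureB12AsPrintedHistoryContagionShiftFlowZeroTangentLimit — ASYMPTOTIC FREEDOM IS CONTAGIOUS, part 67: THE ULTRAVIOLET LIMIT OF THE LINEAR
# MEMORY EQUATION, AND THE ASYMPTOTIC-FREEDOM WEIGHTS.  Part 66 solved the linear memory equation `W_k = s_k − Σ_{p<k} Σ_j c_{p,j}·v_{p+1+j}·W_{p+1+j}` in the bounded
# sequences (a sup-norm contraction over all scales under `|c_{p,j}| ≤ C_mθ^j`, `|v_q| ≤ w_q∕2`, w antitone with partial sums ≤ S, `C_mS ≤ 1 − θ`).  Here (§110): the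
# ULTRAVIOLET INCREMENTS of a bounded solution are controlled by the weight TAIL, **`|(W_k − W_n) − (s_k − s_n)| ≤ (C_mM∕(2(1−θ)))·Σ_{n≤p<k} w_{p+1}`**, so when the source
# converges and the tails vanish the solution HAS AN ULTRAVIOLET LIMIT `W_∞ = lim_k W_k` with an explicit rate (`fixedPoint_limit_exists`) — in part 69 this limit is
# `(−e³∕2)·Λ′(e)`, the pin-derivative of the Λ-coordinate; and (§111) node U2's asymptotic-freedom weights `w_q = (1∕(4f²) + (β*∕4)q)^{−3∕2}` (the profile at base 2f, rate β*∕4 —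
# the Jacobian `h_q³` of an AF trajectory below 2f) ARE such a weight: non-negative, antitone, partial sums `≤ 8f³ + 16f∕β*` (`sum_profWeights_le`, part 14's constant), and
# TELESCOPING TAILS **`Σ_{n≤p<k} w_{p+1} ≤ (8∕β*)·(1∕(4f²) + (β*∕4)n)^{−1∕2} ≤ 16∕(β*√(β*n))`** — UNIFORM IN THE PIN f, which is what makes the ultraviolet limits of parts
# 68–69 uniform over the small box (β-flow team, prover 1, unit `b2b-balaban-beta-bflow-p1`, gen 42; ROW AP-I·Uc × NODE U2)

HONEST FRAMING (page 1 of everything the β sub-cell writes): discharging `BetaPertH` makes Bałaban's UV stability UNCONDITIONAL — a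
real constructive-QFT result; it is NOT the continuum limit and NOT the Clay problem.  HONEST DEPENDENCY (cell reorg 2026-08-19,
verbatim): «continuum YM on T⁴ ⇐ BetaPertH ∧ nine spine estimates (0/9 proved); BetaPertH ⇐ (D1) ∧ (D4) ∧ CAP+tail; G-an2-4 gates
asym, D1 and NE2/3/4.»  THIS MODULE DISCHARGES NOTHING: [folklore] real analysis (finite sums between two scales, Cauchy sequences in ℝ, a telescoping sum, one square
root) over part 66 and node U2's profile letters `T4CouplingMatching.{prof, sprof, sum_profWeights_le, inv_cube_le_telescope, sprof_sq_diff}`, consumed BY NAME; NO functional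
B appears.  [I] = T. Bałaban, Commun. Math. Phys. **109** (1987) [Balaban1987RG1] prints the recursion (0.20) p. 256 and Theorem 2 (0.31) p. 259 (STATED WITHOUT PROOF);
the profile is the shape of (0.31)'s lower half; a derivative of the coupling flow in its datum is printed nowhere in [I].  Nothing of Bałaban's β is asserted.

WHAT THIS FILE PROVES (0 sorry, 0 def): §110 `fixedPoint_tail_abs_le`, `exists_limit_of_tail`, **`fixedPoint_limit_exists`**; §111 `profWeight_nonneg`, `profWeight_anti`,
`sum_profWeight_le`, `sum_profWeight_succ_le`, **`sum_Ico_profWeight_le`**, **`inv_sprof_le_of_pos`**, `inv_sprof_tendsto_zero`.  NOT CLAIMED: anything about a functional B (part 68); anything about Bałaban's β; `BetaPertH`;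
the continuum limit of the measures; Clay.
-/

namespace Summit.QuantumFields.BalabanUV.Beta.EriceFlowEnclosureB12AsPrintedHistoryContagionShiftFlowZeroTangentLimit

open Finset Filter Topology
open Literature.MathematicalPhysics.QuantumFieldTheory.Balaban1983to89
open Literature.MathematicalPhysics.QuantumFieldTheory.Balaban1983to89.T4CouplingMatching (prof sprof sprof_pos sprof_sq prof_pos sprof_zero sum_profWeights_le
  inv_cube_le_telescope sprof_sq_diff)
open Summit.QuantumFields.BalabanUV.Beta.EriceFlowEnclosureB12AsPrintedHistoryContagion (sprof_le_sprof)
open Summit.QuantumFields.BalabanUV.Beta.EriceFlowEnclosureB12AsPrintedHistoryContagionShiftFlowZeroTangent (kernel_tail_abs_le abs_term_le)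

noncomputable section

/-! ## §110 The ultraviolet limit of a bounded solution -/

/-- THE ULTRAVIOLET INCREMENTS ARE CONTROLLED BY THE WEIGHT TAIL: for a bounded solution (|W| ≤ M) and scales n ≤ k,
`|(W_k − W_n) − (s_k − s_n)| ≤ (C_m(M∕2)∕(1−θ))·Σ_{n≤p<k} w_{p+1}`. [folklore] -/
theorem fixedPoint_tail_abs_le {Cm θ M : ℝ} {w : ℕ → ℝ} {c : ℕ → ℕ → ℝ} {v s W : ℕ → ℝ} (hCm : 0 ≤ Cm) (hθ0 : 0 ≤ θ) (hθ1 : θ < 1)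
    (hwanti : ∀ {a b : ℕ}, a ≤ b → w b ≤ w a) (hc : ∀ p j, |c p j| ≤ Cm * θ ^ j) (hv : ∀ q, |v q| ≤ w q / 2)
    (hW : ∀ k, W k = s k - ∑ p ∈ range k, ∑' j, c p j * v (p + 1 + j) * W (p + 1 + j)) (hWM : ∀ q, |W q| ≤ M)
    {n k : ℕ} (hnk : n ≤ k) :
    |(W k - W n) - (s k - s n)| ≤ Cm * (M / 2) / (1 - θ) * ∑ p ∈ Ico n k, w (p + 1) := by
  have hM : 0 ≤ M := (abs_nonneg _).trans (hWM 0)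
  have hsplit := Finset.sum_range_add_sum_Ico (fun p => ∑' j, c p j * v (p + 1 + j) * W (p + 1 + j)) hnk
  have e : (W k - W n) - (s k - s n) = -∑ p ∈ Ico n k, ∑' j, c p j * v (p + 1 + j) * W (p + 1 + j) := by
    rw [hW k, hW n, ← hsplit]; ring
  rw [e, abs_neg]
  exact kernel_tail_abs_le hθ0 hθ1 hwanti (by positivity) hCm (abs_term_le hCm hθ0 hc hv hWM) n k

/-- A real sequence whose increments beyond n are bounded by `τ_n → 0` converges, and the limit is `τ_n`-close to the n-th term. [folklore] -/
theorem exists_limit_of_tail {W τ : ℕ → ℝ} (hcau : ∀ n k, n ≤ k → |W k - W n| ≤ τ n) (hτ : Tendsto τ atTop (𝓝 0)) :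
    ∃ L : ℝ, Tendsto W atTop (𝓝 L) ∧ ∀ n, |L - W n| ≤ τ n := by
  have hc : CauchySeq W := by
    refine Metric.cauchySeq_iff'.2 fun ε hε => ?_
    obtain ⟨N, hN⟩ := (Metric.tendsto_atTop.1 hτ) ε hε
    refine ⟨N, fun n hn => ?_⟩
    have h1 := hN N le_rfl
    rw [Real.dist_eq, sub_zero] at h1
    rw [Real.dist_eq]
    exact (hcau N n hn).trans_lt (lt_of_abs_lt h1)
  obtain ⟨L, hL⟩ := cauchySeq_tendsto_of_complete hc
  refine ⟨L, hL, fun n => ?_⟩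
  have h := ((continuous_abs.tendsto _).comp ((hL.sub_const (W n))))
  exact le_of_tendsto h (eventually_atTop.2 ⟨n, fun k hk => hcau n k hk⟩)

/-- **THE ULTRAVIOLET LIMIT OF THE BOUNDED SOLUTION EXISTS** when the source converges and the weight tails vanish: `s_k → s_∞`, `Σ_{n≤p<k} w_{p+1} ≤ τ_n → 0` ⟹
`W_k → W_∞` with `|W_∞ − W_n − (s_∞ − s_n)| ≤ (C_m(M∕2)∕(1−θ))·τ_n`. [folklore] -/
theorem fixedPoint_limit_exists {Cm θ M sinf : ℝ} {w τ : ℕ → ℝ} {c : ℕ → ℕ → ℝ} {v s W : ℕ → ℝ} (hCm : 0 ≤ Cm) (hθ0 : 0 ≤ θ) (hθ1 : θ < 1)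
    (hwanti : ∀ {a b : ℕ}, a ≤ b → w b ≤ w a) (hc : ∀ p j, |c p j| ≤ Cm * θ ^ j) (hv : ∀ q, |v q| ≤ w q / 2)
    (hW : ∀ k, W k = s k - ∑ p ∈ range k, ∑' j, c p j * v (p + 1 + j) * W (p + 1 + j)) (hWM : ∀ q, |W q| ≤ M)
    (htail : ∀ n k, n ≤ k → ∑ p ∈ Ico n k, w (p + 1) ≤ τ n) (hτ : Tendsto τ atTop (𝓝 0)) (hs : Tendsto s atTop (𝓝 sinf)) :
    ∃ Winf : ℝ, Tendsto W atTop (𝓝 Winf) ∧ ∀ n, |(Winf - W n) - (sinf - s n)| ≤ Cm * (M / 2) / (1 - θ) * τ n := by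
  have h1θ : 0 < 1 - θ := by linarith
  have hM : 0 ≤ M := (abs_nonneg _).trans (hWM 0)
  have hK : 0 ≤ Cm * (M / 2) / (1 - θ) := by positivity
  -- the sequence W − s has small increments
  have hcau : ∀ n k, n ≤ k → |(W k - s k) - (W n - s n)| ≤ Cm * (M / 2) / (1 - θ) * τ n := by
    intro n k hnk
    have h := fixedPoint_tail_abs_le hCm hθ0 hθ1 hwanti hc hv hW hWM hnk
    rw [show (W k - s k) - (W n - s n) = (W k - W n) - (s k - s n) by ring]
    exact h.trans (mul_le_mul_of_nonneg_left (htail n k hnk) hK)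
  have hτ' : Tendsto (fun n => Cm * (M / 2) / (1 - θ) * τ n) atTop (𝓝 0) := by simpa using hτ.const_mul (Cm * (M / 2) / (1 - θ))
  obtain ⟨L, hL, hLn⟩ := exists_limit_of_tail hcau hτ'
  refine ⟨L + sinf, ?_, fun n => ?_⟩
  · have h := hL.add hs
    refine h.congr fun k => ?_
    ring
  · have := hLn n
    rwa [show L + sinf - W n - (sinf - s n) = L - (W n - s n) by ring]

/-! ## §111 The asymptotic-freedom weights `w_q = (1∕(4f²) + (β*∕4)q)^{−3∕2}` (node U2's profile at base 2f, rate β*∕4) -/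

/-- The AF weight is non-negative. [folklore] -/
theorem profWeight_nonneg {bs f : ℝ} (hbs : 0 < bs) (hf : 0 < f) (q : ℕ) :
    0 ≤ 1 / (sprof (2 * f) (bs / 4) q) ^ 2 * (1 / sprof (2 * f) (bs / 4) q) := by
  have hp := sprof_pos (by positivity : 0 < 2 * f) (by positivity : 0 ≤ bs / 4) q
  positivity

/-- The AF weight is antitone in the scale. [folklore] -/
theorem profWeight_anti {bs f : ℝ} (hbs : 0 < bs) (hf : 0 < f) {a b : ℕ} (hab : a ≤ b) :
    1 / (sprof (2 * f) (bs / 4) b) ^ 2 * (1 / sprof (2 * f) (bs / 4) b)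
      ≤ 1 / (sprof (2 * f) (bs / 4) a) ^ 2 * (1 / sprof (2 * f) (bs / 4) a) := by
  have h2f : 0 < 2 * f := by positivity
  have hb4 : 0 ≤ bs / 4 := by positivity
  have hp0 := sprof_pos h2f hb4
  have h1 : 1 / sprof (2 * f) (bs / 4) b ≤ 1 / sprof (2 * f) (bs / 4) a :=
    one_div_le_one_div_of_le (hp0 a) (sprof_le_sprof hb4 hab)
  have h2 : 1 / (sprof (2 * f) (bs / 4) b) ^ 2 ≤ 1 / (sprof (2 * f) (bs / 4) a) ^ 2 :=
    one_div_le_one_div_of_le (pow_pos (hp0 a) 2) (pow_le_pow_left₀ (hp0 a).le (sprof_le_sprof hb4 hab) 2)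
  exact mul_le_mul h2 h1 (one_div_pos.mpr (hp0 b)).le (by positivity)

/-- The AF weights have partial sums `Σ_{q≤m} w_q ≤ 8f³ + 16f∕β*` (node U2's `sum_profWeights_le`, reflected). [folklore] -/
theorem sum_profWeight_le {bs f : ℝ} (hbs : 0 < bs) (hf : 0 < f) (m : ℕ) :
    ∑ q ∈ range (m + 1), 1 / (sprof (2 * f) (bs / 4) q) ^ 2 * (1 / sprof (2 * f) (bs / 4) q) ≤ 8 * f ^ 3 + 16 * f / bs := by
  have h2f : 0 < 2 * f := by positivity
  have hb4 : 0 < bs / 4 := by positivity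
  set w : ℕ → ℝ := fun q => 1 / (sprof (2 * f) (bs / 4) q) ^ 2 * (1 / sprof (2 * f) (bs / 4) q) with hw
  have h2 : ∑ q ∈ range (m + 1), w q = ∑ i ∈ range (m + 1), w (m - i) := by
    rw [← Finset.sum_range_reflect w (m + 1)]
    exact Finset.sum_congr rfl fun i _ => congrArg w (by omega)
  have h3 : ∑ i ∈ range (m + 1), 1 / (sprof (2 * f) (bs / 4) (m - i)) ^ 2 * (1 / sprof (2 * f) (bs / 4) (m - i))
      ≤ (2 * f) ^ 3 + 2 * (2 * f) / (bs / 4) := sum_profWeights_le h2f hb4 m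
  have h4 : (2 * f) ^ 3 + 2 * (2 * f) / (bs / 4) = 8 * f ^ 3 + 16 * f / bs := by
    field_simp
    ring
  calc ∑ q ∈ range (m + 1), w q = ∑ i ∈ range (m + 1), w (m - i) := h2
    _ ≤ (2 * f) ^ 3 + 2 * (2 * f) / (bs / 4) := h3
    _ = 8 * f ^ 3 + 16 * f / bs := h4

/-- The shifted partial sums of the AF weights: `Σ_{p<k} w_{p+1} ≤ 8f³ + 16f∕β*`. [folklore] -/
theorem sum_profWeight_succ_le {bs f : ℝ} (hbs : 0 < bs) (hf : 0 < f) (k : ℕ) :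
    ∑ p ∈ range k, 1 / (sprof (2 * f) (bs / 4) (p + 1)) ^ 2 * (1 / sprof (2 * f) (bs / 4) (p + 1)) ≤ 8 * f ^ 3 + 16 * f / bs := by
  have h1 : ∑ p ∈ range k, 1 / (sprof (2 * f) (bs / 4) (p + 1)) ^ 2 * (1 / sprof (2 * f) (bs / 4) (p + 1))
      ≤ ∑ q ∈ range (k + 1), 1 / (sprof (2 * f) (bs / 4) q) ^ 2 * (1 / sprof (2 * f) (bs / 4) q) := by
    rw [Finset.sum_range_succ' (fun q => 1 / (sprof (2 * f) (bs / 4) q) ^ 2 * (1 / sprof (2 * f) (bs / 4) q))]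
    linarith [profWeight_nonneg hbs hf 0]
  exact h1.trans (sum_profWeight_le hbs hf k)

/-- **THE AF WEIGHT TAIL TELESCOPES**: `Σ_{n≤p<k} w_{p+1} ≤ (8∕β*)·(1∕(4f²) + (β*∕4)n)^{−1∕2}` (node U2's `inv_cube_le_telescope`: `a_{p+1}^{−3∕2} ≤ (2∕b)(a_p^{−1∕2} − a_{p+1}^{−1∕2})`,
`b = β*∕4`). [folklore] -/
theorem sum_Ico_profWeight_le {bs f : ℝ} (hbs : 0 < bs) (hf : 0 < f) (n k : ℕ) :
    ∑ p ∈ Ico n k, 1 / (sprof (2 * f) (bs / 4) (p + 1)) ^ 2 * (1 / sprof (2 * f) (bs / 4) (p + 1)) ≤ 8 / bs * (1 / sprof (2 * f) (bs / 4) n) := by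
  have h2f : 0 < 2 * f := by positivity
  have hb4 : 0 < bs / 4 := by positivity
  have hp0 := sprof_pos h2f hb4.le
  set g : ℕ → ℝ := fun p => 1 / sprof (2 * f) (bs / 4) p with hg
  have hg0 : ∀ p, 0 ≤ g p := fun p => (one_div_pos.mpr (hp0 p)).le
  have hstep : ∀ p, 1 / (sprof (2 * f) (bs / 4) (p + 1)) ^ 2 * (1 / sprof (2 * f) (bs / 4) (p + 1)) ≤ 2 / (bs / 4) * (g p - g (p + 1)) := fun p =>
    inv_cube_le_telescope (hp0 p) (sprof_le_sprof hb4.le (Nat.le_succ p)) hb4 (sprof_sq_diff h2f hb4.le p)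
  rcases le_or_gt n k with hnk | hkn
  · calc ∑ p ∈ Ico n k, 1 / (sprof (2 * f) (bs / 4) (p + 1)) ^ 2 * (1 / sprof (2 * f) (bs / 4) (p + 1))
        ≤ ∑ p ∈ Ico n k, 2 / (bs / 4) * (g p - g (p + 1)) := Finset.sum_le_sum fun p _ => hstep p
      _ = 2 / (bs / 4) * (g n - g k) := by
          rw [← Finset.mul_sum, Finset.sum_Ico_eq_sum_range]
          congr 1
          have h := Finset.sum_range_sub' (fun i => g (n + i)) (k - n)
          simp only [add_zero, show n + (k - n) = k by omega] at h
          rw [← h]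
          exact Finset.sum_congr rfl fun i _ => by rw [add_assoc]
      _ ≤ 2 / (bs / 4) * g n := by
          have := hg0 k
          have h8 : 0 < 2 / (bs / 4) := by positivity
          nlinarith
      _ = 8 / bs * (1 / sprof (2 * f) (bs / 4) n) := by rw [hg]; field_simp; ring
  · rw [Finset.Ico_eq_empty (by omega), Finset.sum_empty]
    have := hg0 n
    positivity

/-- The AF coupling profile is below `2∕√(β*n)` WHATEVER THE PIN: `(1∕(4f²) + (β*∕4)n)^{−1∕2} ≤ 2∕√(β*·n)` for n ≥ 1 — the weight tails vanish UNIFORMLY in f. [folklore] -/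
theorem inv_sprof_le_of_pos {bs f : ℝ} (hbs : 0 < bs) (hf : 0 < f) {n : ℕ} (hn : 1 ≤ n) :
    1 / sprof (2 * f) (bs / 4) n ≤ 2 / Real.sqrt (bs * n) := by
  have h2f : 0 < 2 * f := by positivity
  have hb4 : 0 ≤ bs / 4 := by positivity
  have hn' : (1 : ℝ) ≤ n := by exact_mod_cast hn
  have hbn : 0 < bs * n := by positivity
  have hs : Real.sqrt (bs * n) / 2 ≤ sprof (2 * f) (bs / 4) n := by
    rw [show Real.sqrt (bs * n) / 2 = Real.sqrt (bs * n / 4) by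
      rw [Real.sqrt_div' _ (by norm_num : (0:ℝ) ≤ 4), show Real.sqrt 4 = 2 by
        rw [show (4:ℝ) = 2 ^ 2 by norm_num, Real.sqrt_sq (by norm_num)]]]
    unfold T4CouplingMatching.sprof T4CouplingMatching.prof
    refine Real.sqrt_le_sqrt ?_
    have : 0 ≤ 1 / (2 * f) ^ 2 := by positivity
    linarith
  calc 1 / sprof (2 * f) (bs / 4) n ≤ 1 / (Real.sqrt (bs * n) / 2) :=
        one_div_le_one_div_of_le (by positivity) hs
    _ = 2 / Real.sqrt (bs * n) := by field_simp

/-- The AF coupling profile vanishes in the ultraviolet: `(1∕γ² + b·n)^{−1∕2} → 0`. [folklore] -/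
theorem inv_sprof_tendsto_zero {γ b : ℝ} (hb : 0 < b) : Tendsto (fun n : ℕ => 1 / sprof γ b n) atTop (𝓝 0) := by
  have h1 : Tendsto (fun n : ℕ => 1 / γ ^ 2 + b * (n : ℝ)) atTop atTop :=
    tendsto_const_nhds.add_atTop (tendsto_natCast_atTop_atTop.const_mul_atTop hb)
  have h2 : Tendsto (fun n : ℕ => sprof γ b n) atTop atTop := by
    unfold T4CouplingMatching.sprof T4CouplingMatching.prof
    exact Real.tendsto_sqrt_atTop.comp h1
  have h3 := tendsto_inv_atTop_zero.comp h2
  refine h3.congr fun n => ?_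
  simp [one_div]

end

end Summit.QuantumFields.BalabanUV.Beta.EriceFlowEnclosureB12AsPrintedHistoryContagionShiftFlowZeroTangentLimit
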